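import Summits.AtomisticToContinuum.FouriersLaw.Theorems.EmbeddedDrudeMourreMourreDissolutionFrameworkReduction
import Summits.AtomisticToContinuum.FouriersLaw.Theorems.EmbeddedDrudeMourreMourreDissolutionGibbsClustering
import Summits.AtomisticToContinuum.FouriersLaw.Theorems.EmbeddedDrudeMourreMourreDissolutionFrameworkReflection
import HarnessLib

/-!
# The symmetric zero-wavenumber framework of the pinned anharmonic chain — stub `stub_zeroWavenumberFramework` of line `swap-odd-threshold-rigidity`
(crux `EmbeddedDrudeMourre.MourreDissolution`, item stmt-AtomisticToContinuum-12594; helper file, `--supports`)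

Registered stub E of the checked skeleton of line `swap-odd-threshold-rigidity` (lead c7), in the
skeleton's stub namespace `Summit.AtomisticToContinuum.FouriersLaw.Theorems.MourreDissolution`.

For `pinnedChain ω₂ lam β γ` (all couplings `> 0`) and every `T > 0` there are an infinite-volume
dynamics `D` and a zero-wavenumber datum `Z : ZeroWavenumberData (pinnedChain …) D` such that `Z.μ` is
a DLR Gibbs state at `T` obeying the superstability estimate, the momentum reversal is a symmetry of
the datum, the Koopman group on `ℋ₀(Z.μ)` is strongly continuous, and the spatial reflection
`ι σ = σ(-·)` preserves `Z.μ`, `D.carrier` and `Z.localObs` and commutes with the flow `Z.μ`-a.e.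

Proof (assembly only, ≈ 10 lines): the separable-vertex line PROVED this framework —
`symmetricFramework_of_clustering` (the reduction to the scalar clustering hypothesis (H), file
`…FrameworkReduction`) fed with the landed clustering statement `stub_gibbsClustering` (file
`…GibbsClustering`: transfer-operator DLR state of the 1-D chain, Buttà–Marchioro dynamics on the
superstable set `bmGood`, exponential mixing + `L²` light-cone locality ⇒ space–time clustering)
gives `D` with `D.carrier = bmGood` and, at every `T > 0`, the datum `Z` with every clause but the
carrier one; strong continuity of `Z.toFluctuationDynamics` is by definition the continuity of
`t ↦ Z.koopman t ψ`; and `MapsTo ι D.carrier D.carrier` is `mapsTo_reflect_bmGood` (file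
`…FrameworkReflection`) once `D.carrier = bmGood`.
-/

noncomputable section

namespace Summit.AtomisticToContinuum.FouriersLaw.Theorems.MourreDissolution

open MeasureTheory Filter Set Function Topology
open scoped InnerProductSpace ENNReal
open Literature.MathematicalPhysics.KineticTheory
open Literature.MathematicalPhysics.KineticTheory.HeatConduction
open Literature.MathematicalPhysics.KineticTheory.PhononBoltzmann

/-- **Stub E of line `swap-odd-threshold-rigidity` (`stub_zeroWavenumberFramework`): the symmetric
zero-wavenumber framework of the anharmonic pinned chain at every temperature.** For
`pinnedChain ω₂ lam β γ` (`ω₂, lam, β, γ > 0`) and every `T > 0` there exist an infinite-volume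
dynamics `D` (the Buttà–Marchioro group on the superstable set `bmGood`) and a zero-wavenumber datum
`Z` over `D` whose state is a DLR Gibbs state at `T` with the superstability estimate, with momentum
reversal a symmetry of the datum, strongly continuous Koopman group on `ℋ₀`, and the spatial
reflection `ι` preserving `Z.μ`, `D.carrier`, `Z.localObs` and commuting with the flow a.e.
Assembly of `symmetricFramework_of_clustering`, `stub_gibbsClustering` and `mapsTo_reflect_bmGood`.
[cite: ButtaMarchioro2016, §2 Thm 2.1–2.2] -/
theorem stub_zeroWavenumberFramework :
    ∀ ω₂ lam β γ : ℝ, 0 < ω₂ → 0 < lam → 0 < β → 0 < γ → ∀ T : ℝ, 0 < T →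
      ∃ (D : InfiniteChainDynamics (pinnedChain ω₂ lam β γ))
        (Z : ZeroWavenumberData (pinnedChain ω₂ lam β γ) D),
        (pinnedChain ω₂ lam β γ).IsChainGibbsMeasure T Z.μ ∧
        (pinnedChain ω₂ lam β γ).HasSuperstabilityEstimate Z.μ ∧
        Z.HasMomentumReversal ∧
        Z.toFluctuationDynamics.IsStronglyContinuous ∧
        MeasurePreserving (fun (σ : ChainConfig) (i : ℤ) => σ (-i)) Z.μ Z.μ ∧
        Set.MapsTo (fun (σ : ChainConfig) (i : ℤ) => σ (-i)) D.carrier D.carrier ∧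
        (∀ a ∈ Z.localObs, (a ∘ fun (σ : ChainConfig) (i : ℤ) => σ (-i)) ∈ Z.localObs) ∧
        (∀ t : ℝ, (fun (σ : ChainConfig) (i : ℤ) => σ (-i)) ∘ D.flow t =ᵐ[Z.μ]
          D.flow t ∘ fun (σ : ChainConfig) (i : ℤ) => σ (-i)) := by
  intro ω₂ lam β γ hω hl hβ hγ T hT
  obtain ⟨D, hcar, hT'⟩ :=
    symmetricFramework_of_clustering stub_gibbsClustering ω₂ lam β γ hω hl hβ hγ
  obtain ⟨Z, hG, hSS, hR, hι, hιobs, hιflow, hsc⟩ := hT' T hT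
  refine ⟨D, Z, hG, hSS, hR, fun ψ => hsc ψ, hι, ?_, hιobs, hιflow⟩
  rw [hcar]
  exact mapsTo_reflect_bmGood _

end Summit.AtomisticToContinuum.FouriersLaw.Theorems.MourreDissolution

end
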